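import Summits.SmoothPoincare4.SmoothPoincare4.Theses.EntropyRung
import Summits.SmoothPoincare4.SmoothPoincare4.Theorems.EntropyRungSubcylindricalExistenceGluingAllScalesSchwarzschild
import Summits.SmoothPoincare4.SmoothPoincare4.Theorems.EntropyRungSubcylindricalExistenceYamabeSobolevOfNonneg
import HarnessLib

/-!
# Stub D' `stub_conformalGluingSchwarzschild` of line `green-blowup-conformal-entropy`
# (reshape R-c3 "Schwarzschild gauge"; crux `EntropyRung.SubcylindricalExistence`, stmt-SmoothPoincare4-10871, lead c3)

The gluing for Perelman's `μ`-entropy with the CONFORMALLY ROUND cap. Given (by text) the worker stubs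
of the reshape — S3' `stub_capFactorSchwarzschild`, S5' `stub_capMetricVolumeSchwarzschild`,
Cut' `stub_cutoffSqIntegralSchwarzschild`, S2'M `stub_sphereSideClauseSchwarzschild` (fed E2
`stub_capClauseEuclideanSchwarzschild`; all four enter only through their closed forms) — Green data
`(g, p, G, a, b, r)` in the flat gauge WITH MASS (`G(φ⁻¹y) = a/‖y − y₀‖² + b` on the flat chart ball,
`b ≥ 0` constant) on a closed smooth homotopy 4-sphere whose blow-up clause holds at level `ν_cyl + δ`,
and positive invertibility of `L_g`, there is a smooth `ψ > 0` with `L_g ψ > 0` such that the clause of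
`ψ² g` written on `g` (`e^{−f}`-form, weights `ψ⁴`, `ψ⁻²`, curvature `ψ⁻³L_gψ`) holds at level
`ν_cyl + δ'`, `δ' = min(δ, 0.026)/8`. The analytic content is
`GluingAllScalesSchwarzschild.allScales_clause` (choice of `ε, θ, S, ρ₁, Λ, K`; small scales by IMS
localisation with the perturbative cap clause at level `log 6 − 2 − 4ε` and the core comparison, large
scales by the Yamabe–Sobolev propagation); here we only specialise the by-text stubs, take
`u₀ = L_g⁻¹ 1` for S4 (`stub_yamabeSobolevOfNonneg`, landed, imported), and pass to the `e^{−f}`-form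
with `gluingExpForm` (landed). Everything is proved; no definitions, no named facts. The reduction of
the crux to the transfer stub Â_b `stub_schwarzschildBlowupExistence` is landed separately once the
four worker stubs are in the tree (it needs them by name).
-/

noncomputable section

set_option linter.dupNamespace false

open scoped Manifold ContDiff Topology RealInnerProductSpace ContinuousMap
open Set Filter MeasureTheory
open Literature.Geometry.Lorentzian

namespace Summit.SmoothPoincare4.SmoothPoincare4.Theorems

set_option maxHeartbeats 800000 in
-- the registered statement threads four long by-text stubs; elaborating the statement and the final
-- term needs about 3× the default budget (all tactic steps are elementary)
/-- **Stub D' — the gluing for `μ` with the conformally-round cap** (registered stub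
`stub_conformalGluingSchwarzschild` of line `green-blowup-conformal-entropy`, reshape R-c3; see the
module docstring). [cite: Perelman2002Entropy, §3.1] -/
theorem stub_conformalGluingSchwarzschild :
    (∀ (M : Type) [TopologicalSpace M] [T2Space M] [SecondCountableTopology M]
      [ChartedSpace (EuclideanSpace ℝ (Fin 4)) M] [IsManifold (𝓡 4) ∞ M] [CompactSpace M]
      [T3Space M] [MeasurableSpace M] [BorelSpace M]
      (g : PseudoRiemannianMetric (𝓡 4) ∞ (EuclideanSpace ℝ (Fin 4)) (TangentSpace (𝓡 4) : M → Type _))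
      [g.HasLeviCivita], g.IsRiemannian → (∀ x, 0 ≤ g.scalarCurvature x) →
      ∀ (p : M) (G : M → ℝ),
        (ContMDiffOn (𝓡 4) 𝓘(ℝ, ℝ) ∞ G {p}ᶜ ∧ (∀ x, x ≠ p → 0 < G x) ∧
          (∀ x, x ≠ p → g.scalarCurvature x * G x - 6 * g.dalembertian G x = 0) ∧
          Tendsto G (𝓝[≠] p) atTop) →
      ∀ (a b r : ℝ), 0 < a → 0 ≤ b → 0 < r →
        Metric.closedBall (extChartAt (𝓡 4) p p) r ⊆ (extChartAt (𝓡 4) p).target →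
        (∀ y ∈ Metric.closedBall (extChartAt (𝓡 4) p p) r, ∀ X W : EuclideanSpace ℝ (Fin 4),
          g.val ((extChartAt (𝓡 4) p).symm y)
            (mfderiv 𝓘(ℝ, EuclideanSpace ℝ (Fin 4)) (𝓡 4) (extChartAt (𝓡 4) p).symm y X)
            (mfderiv 𝓘(ℝ, EuclideanSpace ℝ (Fin 4)) (𝓡 4) (extChartAt (𝓡 4) p).symm y W) = ⟪X, W⟫) →
        (∀ y ∈ Metric.closedBall (extChartAt (𝓡 4) p p) r, y ≠ extChartAt (𝓡 4) p p →
          G ((extChartAt (𝓡 4) p).symm y) = a / ‖y - extChartAt (𝓡 4) p p‖ ^ 2 + b) →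
        (∀ x, g.scalarCurvature x = 0 → x ∈ (extChartAt (𝓡 4) p).source ∧
          extChartAt (𝓡 4) p x ∈ Metric.closedBall (extChartAt (𝓡 4) p p) r) →
      ∀ (K : ℝ), 0 < K →
        ∃ ψ : M → ℝ, ContMDiff (𝓡 4) 𝓘(ℝ, ℝ) ∞ ψ ∧ (∀ x, 0 < ψ x) ∧
          (∀ x, 0 < g.scalarCurvature x * ψ x - 6 * g.dalembertian ψ x) ∧
          (∀ x, x ≠ p → ψ x = 4 * K * G x / (4 * K + G x)) ∧ ψ p = 4 * K) →
    (∀ (M : Type) [TopologicalSpace M] [T2Space M] [SecondCountableTopology M]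
      [ChartedSpace (EuclideanSpace ℝ (Fin 4)) M] [IsManifold (𝓡 4) ∞ M] [CompactSpace M]
      [T3Space M] [MeasurableSpace M] [BorelSpace M]
      (g : PseudoRiemannianMetric (𝓡 4) ∞ (EuclideanSpace ℝ (Fin 4)) (TangentSpace (𝓡 4) : M → Type _))
      [g.HasLeviCivita] (hg : g.IsRiemannian) (p : M) (G : M → ℝ),
        (ContMDiffOn (𝓡 4) 𝓘(ℝ, ℝ) ∞ G {p}ᶜ ∧ (∀ x, x ≠ p → 0 < G x) ∧
          (∀ x, x ≠ p → g.scalarCurvature x * G x - 6 * g.dalembertian G x = 0) ∧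
          Tendsto G (𝓝[≠] p) atTop) →
      ∀ (a b r : ℝ), 0 < a → 0 ≤ b → 0 < r →
        Metric.closedBall (extChartAt (𝓡 4) p p) r ⊆ (extChartAt (𝓡 4) p).target →
        (∀ y ∈ Metric.closedBall (extChartAt (𝓡 4) p p) r, ∀ X W : EuclideanSpace ℝ (Fin 4),
          g.val ((extChartAt (𝓡 4) p).symm y)
            (mfderiv 𝓘(ℝ, EuclideanSpace ℝ (Fin 4)) (𝓡 4) (extChartAt (𝓡 4) p).symm y X)
            (mfderiv 𝓘(ℝ, EuclideanSpace ℝ (Fin 4)) (𝓡 4) (extChartAt (𝓡 4) p).symm y W) = ⟪X, W⟫) →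
        (∀ y ∈ Metric.closedBall (extChartAt (𝓡 4) p p) r, y ≠ extChartAt (𝓡 4) p p →
          G ((extChartAt (𝓡 4) p).symm y) = a / ‖y - extChartAt (𝓡 4) p p‖ ^ 2 + b) →
      ∃ C₁ C₂ : ℝ, ∀ (K : ℝ), 0 < K → ∀ (ψ : M → ℝ), ContMDiff (𝓡 4) 𝓘(ℝ, ℝ) ∞ ψ →
        (∀ x, x ≠ p → ψ x = 4 * K * G x / (4 * K + G x)) → ψ p = 4 * K →
        ∫ x, (ψ x) ^ 4 ∂(riemannianMeasure (g.toContMDiffRiemannianMetric hg)) ≤ C₁ + C₂ * K ^ 2) →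
    (∀ (M : Type) [TopologicalSpace M] [T2Space M] [SecondCountableTopology M]
      [ChartedSpace (EuclideanSpace ℝ (Fin 4)) M] [IsManifold (𝓡 4) ∞ M] [CompactSpace M]
      [T3Space M] [MeasurableSpace M] [BorelSpace M]
      (g : PseudoRiemannianMetric (𝓡 4) ∞ (EuclideanSpace ℝ (Fin 4)) (TangentSpace (𝓡 4) : M → Type _))
      [g.HasLeviCivita] (hg : g.IsRiemannian) (p : M) (G : M → ℝ),
      ContMDiffOn (𝓡 4) 𝓘(ℝ, ℝ) ∞ G {p}ᶜ → ∀ (a b r : ℝ), 0 < a → 0 ≤ b → 0 < r →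
      Metric.closedBall (extChartAt (𝓡 4) p p) r ⊆ (extChartAt (𝓡 4) p).target →
      (∀ y ∈ Metric.closedBall (extChartAt (𝓡 4) p p) r, ∀ X W : EuclideanSpace ℝ (Fin 4),
          g.val ((extChartAt (𝓡 4) p).symm y)
            (mfderiv 𝓘(ℝ, EuclideanSpace ℝ (Fin 4)) (𝓡 4) (extChartAt (𝓡 4) p).symm y X)
            (mfderiv 𝓘(ℝ, EuclideanSpace ℝ (Fin 4)) (𝓡 4) (extChartAt (𝓡 4) p).symm y W) = ⟪X, W⟫) →
      (∀ y ∈ Metric.closedBall (extChartAt (𝓡 4) p p) r, y ≠ extChartAt (𝓡 4) p p →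
          G ((extChartAt (𝓡 4) p).symm y) = a / ‖y - extChartAt (𝓡 4) p p‖ ^ 2 + b) →
      ∀ (C S : ℝ), 0 ≤ C → 2 ≤ S → 2 * b ≤ S → a / r ^ 2 + b < S →
      ∀ (χ₁ χ₂ : M → ℝ), ContMDiff (𝓡 4) 𝓘(ℝ, ℝ) ∞ χ₁ → ContMDiff (𝓡 4) 𝓘(ℝ, ℝ) ∞ χ₂ →
      (∀ y, χ₁ y ^ 2 + χ₂ y ^ 2 = 1) → (∀ x, x ≠ p → G x ≤ S → χ₁ x = 1) →
      (∀ x, x ≠ p → S ^ 2 ≤ G x → χ₁ x = 0) → χ₁ p = 0 →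
      (∀ x, x ≠ p → g.gradSq χ₁ x + g.gradSq χ₂ x ≤ C / Real.log S ^ 2 * ((G x)⁻¹ ^ 2 * g.gradSq G x)) →
      Tendsto G (𝓝[≠] p) atTop →
      (∀ x, x ≠ p → S ≤ G x →
        x ∈ (extChartAt (𝓡 4) p).source ∧ extChartAt (𝓡 4) p x ∈ Metric.ball (extChartAt (𝓡 4) p p) r) →
      ∫ x, (g.gradSq χ₁ x + g.gradSq χ₂ x) ^ 2 ∂(riemannianMeasure (g.toContMDiffRiemannianMetric hg)) ≤
        (C / Real.log S ^ 2) ^ 2 * (32 * Real.pi ^ 2 * Real.log S)) →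
    (∀ (M : Type) [TopologicalSpace M] [T2Space M] [SecondCountableTopology M]
      [ChartedSpace (EuclideanSpace ℝ (Fin 4)) M] [IsManifold (𝓡 4) ∞ M] [CompactSpace M]
      [T3Space M] [MeasurableSpace M] [BorelSpace M]
      (g : PseudoRiemannianMetric (𝓡 4) ∞ (EuclideanSpace ℝ (Fin 4)) (TangentSpace (𝓡 4) : M → Type _))
      [g.HasLeviCivita] (hg : g.IsRiemannian), (∀ x, 0 ≤ g.scalarCurvature x) →
      ∀ (p : M) (G : M → ℝ),
        (ContMDiffOn (𝓡 4) 𝓘(ℝ, ℝ) ∞ G {p}ᶜ ∧ (∀ x, x ≠ p → 0 < G x) ∧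
          (∀ x, x ≠ p → g.scalarCurvature x * G x - 6 * g.dalembertian G x = 0) ∧
          Tendsto G (𝓝[≠] p) atTop) →
      ∀ (a b r : ℝ), 0 < a → 0 ≤ b → 0 < r →
        Metric.closedBall (extChartAt (𝓡 4) p p) r ⊆ (extChartAt (𝓡 4) p).target →
        (∀ y ∈ Metric.closedBall (extChartAt (𝓡 4) p p) r, ∀ X W : EuclideanSpace ℝ (Fin 4),
          g.val ((extChartAt (𝓡 4) p).symm y)
            (mfderiv 𝓘(ℝ, EuclideanSpace ℝ (Fin 4)) (𝓡 4) (extChartAt (𝓡 4) p).symm y X)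
            (mfderiv 𝓘(ℝ, EuclideanSpace ℝ (Fin 4)) (𝓡 4) (extChartAt (𝓡 4) p).symm y W) = ⟪X, W⟫) →
        (∀ y ∈ Metric.closedBall (extChartAt (𝓡 4) p p) r, y ≠ extChartAt (𝓡 4) p p →
          G ((extChartAt (𝓡 4) p).symm y) = a / ‖y - extChartAt (𝓡 4) p p‖ ^ 2 + b) →
      ∀ (K : ℝ), 0 < K → ∀ (ψ : M → ℝ), ContMDiff (𝓡 4) 𝓘(ℝ, ℝ) ∞ ψ →
        (∀ x, x ≠ p → ψ x = 4 * K * G x / (4 * K + G x)) → ψ p = 4 * K →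
      ∀ (ρ₁ θ : ℝ), 0 < ρ₁ → ρ₁ ≤ r → 0 < θ → θ ≤ 1 / 100 → b * ρ₁ ^ 2 ≤ θ * a → b ≤ θ * K →
      ∀ τ : ℝ, 0 < τ → ∀ v : M → ℝ, ContMDiff (𝓡 4) 𝓘(ℝ, ℝ) ∞ v →
        tsupport v ⊆ {x | x ∈ (extChartAt (𝓡 4) p).source ∧
            extChartAt (𝓡 4) p x ∈ Metric.ball (extChartAt (𝓡 4) p p) ρ₁} →
        ∫ x, (4 * Real.pi * τ) ^ (-(4 : ℝ) / 2) * (v x) ^ 2 * (ψ x) ^ 4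
            ∂(riemannianMeasure (g.toContMDiffRiemannianMetric hg)) = 1 →
          Real.log 6 - 2 - 100 * θ ≤
            ∫ x, (τ * ((ψ x ^ 3)⁻¹ * (g.scalarCurvature x * ψ x - 6 * g.dalembertian ψ x) * (v x) ^ 2
                  + 4 * ((ψ x)⁻¹ ^ 2 * g.gradSq v x))
                - (v x) ^ 2 * Real.log ((v x) ^ 2) - 4 * (v x) ^ 2)
                * ((4 * Real.pi * τ) ^ (-(4 : ℝ) / 2) * (ψ x) ^ 4)
              ∂(riemannianMeasure (g.toContMDiffRiemannianMetric hg))) →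
    ∀ (M : Type) [TopologicalSpace M] [T2Space M] [SecondCountableTopology M]
      [ChartedSpace (EuclideanSpace ℝ (Fin 4)) M] [IsManifold (𝓡 4) ∞ M] [CompactSpace M]
      [T3Space M] [MeasurableSpace M] [BorelSpace M],
      M ≃ₕ Metric.sphere (0 : EuclideanSpace ℝ (Fin 5)) 1 →
      ∀ (g : PseudoRiemannianMetric (𝓡 4) ∞ (EuclideanSpace ℝ (Fin 4)) (TangentSpace (𝓡 4) : M → Type _))
        [g.HasLeviCivita] (hg : g.IsRiemannian) (p : M) (G : M → ℝ) (a b r : ℝ),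
        (ContMDiffOn (𝓡 4) 𝓘(ℝ, ℝ) ∞ G {p}ᶜ ∧ (∀ x, x ≠ p → 0 < G x) ∧
          (∀ x, x ≠ p → g.scalarCurvature x * G x - 6 * g.dalembertian G x = 0) ∧
          Tendsto G (𝓝[≠] p) atTop) →
        (∀ x, 0 ≤ g.scalarCurvature x) →
        (∀ x, g.scalarCurvature x = 0 → x ∈ (extChartAt (𝓡 4) p).source ∧
          extChartAt (𝓡 4) p x ∈ Metric.closedBall (extChartAt (𝓡 4) p p) r) →
        0 < a → 0 ≤ b → 0 < r →
        (Metric.closedBall (extChartAt (𝓡 4) p p) r ⊆ (extChartAt (𝓡 4) p).target ∧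
          ∀ y ∈ Metric.closedBall (extChartAt (𝓡 4) p p) r, ∀ X W : EuclideanSpace ℝ (Fin 4),
          g.val ((extChartAt (𝓡 4) p).symm y)
            (mfderiv 𝓘(ℝ, EuclideanSpace ℝ (Fin 4)) (𝓡 4) (extChartAt (𝓡 4) p).symm y X)
            (mfderiv 𝓘(ℝ, EuclideanSpace ℝ (Fin 4)) (𝓡 4) (extChartAt (𝓡 4) p).symm y W) = ⟪X, W⟫) →
        (∀ y ∈ Metric.closedBall (extChartAt (𝓡 4) p p) r, y ≠ extChartAt (𝓡 4) p p →
          G ((extChartAt (𝓡 4) p).symm y) = a / ‖y - extChartAt (𝓡 4) p p‖ ^ 2 + b) →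
        (∃ δ : ℝ, 0 < δ ∧ ∀ τ : ℝ, 0 < τ → ∀ w : M → ℝ, ContMDiff (𝓡 4) 𝓘(ℝ, ℝ) ∞ w →
          w =ᶠ[𝓝 p] 0 →
          ∫ x, (4 * Real.pi * τ) ^ (-(4 : ℝ) / 2) * (w x) ^ 2 * (G x) ^ 4
              ∂(riemannianMeasure (g.toContMDiffRiemannianMetric hg)) = 1 →
            Real.log 2 + Real.log Real.pi / 2 - 3 / 2 + δ ≤
              ∫ x, (4 * τ * ((G x)⁻¹ ^ 2 * g.gradSq w x) - (w x) ^ 2 * Real.log ((w x) ^ 2)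
                  - 4 * (w x) ^ 2) * ((4 * Real.pi * τ) ^ (-(4 : ℝ) / 2) * (G x) ^ 4)
                ∂(riemannianMeasure (g.toContMDiffRiemannianMetric hg))) →
        (∀ F : M → ℝ, ContMDiff (𝓡 4) 𝓘(ℝ, ℝ) ∞ F → (∀ x, 0 < F x) →
          ∃ ψ : M → ℝ, ContMDiff (𝓡 4) 𝓘(ℝ, ℝ) ∞ ψ ∧ (∀ x, 0 < ψ x) ∧
            ∀ x, g.scalarCurvature x * ψ x - 6 * g.dalembertian ψ x = F x) →
        ∃ ψ : M → ℝ, ContMDiff (𝓡 4) 𝓘(ℝ, ℝ) ∞ ψ ∧ (∀ x, 0 < ψ x) ∧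
          (∀ x, 0 < g.scalarCurvature x * ψ x - 6 * g.dalembertian ψ x) ∧
          ∃ δ : ℝ, 0 < δ ∧ ∀ τ : ℝ, 0 < τ → ∀ f : M → ℝ, ContMDiff (𝓡 4) 𝓘(ℝ, ℝ) ∞ f →
            ∫ x, (4 * Real.pi * τ) ^ (-(4 : ℝ) / 2) * Real.exp (-f x) * ψ x ^ 4
                ∂(riemannianMeasure (g.toContMDiffRiemannianMetric hg)) = 1 →
              Real.log 2 + Real.log Real.pi / 2 - 3 / 2 + δ ≤
                ∫ x, (τ * ((ψ x ^ 3)⁻¹ * (g.scalarCurvature x * ψ x - 6 * g.dalembertian ψ x) +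
                      (ψ x ^ 2)⁻¹ * g.gradSq f x) + f x - 4) *
                    ((4 * Real.pi * τ) ^ (-(4 : ℝ) / 2) * Real.exp (-f x)) * ψ x ^ 4
                  ∂(riemannianMeasure (g.toContMDiffRiemannianMetric hg)) := by
  intro hS3 hS5 hCut hS2 M _ _ _ _ _ _ _ _ _ _ g _ hg p G a b r hGreen hR0 hRzero ha hb hr hFlat hGform hBlow hSolve
  obtain ⟨hGs, hGpos, hGeqn, hGlim⟩ := hGreen
  obtain ⟨hsub, hflat⟩ := hFlat
  obtain ⟨δ, hδ, hBlowδ⟩ := hBlow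
  -- `u₀ = L_g⁻¹ 1` and the Yamabe–Sobolev constant of the class (S4, landed)
  obtain ⟨u₀, hu₀, hu₀pos, hLu₀⟩ := hSolve (fun _ ↦ (1 : ℝ)) contMDiff_const (fun _ ↦ one_pos)
  obtain ⟨Y, hY, hYS⟩ := stub_yamabeSobolevOfNonneg M g hg ⟨u₀, hu₀, hu₀pos, hLu₀⟩
  -- the specialised stubs S3', S2'M, S5', Cut'
  have hfac : ∀ K : ℝ, 0 < K → ∃ ψ : M → ℝ, ContMDiff (𝓡 4) 𝓘(ℝ, ℝ) ∞ ψ ∧ (∀ x, 0 < ψ x) ∧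
      (∀ x, 0 < g.scalarCurvature x * ψ x - 6 * g.dalembertian ψ x) ∧
      (∀ x, x ≠ p → ψ x = 4 * K * G x / (4 * K + G x)) ∧ ψ p = 4 * K :=
    fun K hK ↦ hS3 M g hg hR0 p G ⟨hGs, hGpos, hGeqn, hGlim⟩ a b r ha hb hr hsub hflat hGform hRzero K hK
  have hcapall := fun (K : ℝ) (hK : 0 < K) (ψ : M → ℝ) (hψ : ContMDiff (𝓡 4) 𝓘(ℝ, ℝ) ∞ ψ)
      (hψG : ∀ x, x ≠ p → ψ x = 4 * K * G x / (4 * K + G x)) (hψp : ψ p = 4 * K) ↦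
    hS2 M g hg hR0 p G ⟨hGs, hGpos, hGeqn, hGlim⟩ a b r ha hb hr hsub hflat hGform K hK ψ hψ hψG hψp
  obtain ⟨C₁, C₂, hvol⟩ := hS5 M g hg p G ⟨hGs, hGpos, hGeqn, hGlim⟩ a b r ha hb hr hsub hflat hGform
  have hcut := fun (C S : ℝ) (hC : 0 ≤ C) (hS2' : 2 ≤ S) (h2b : 2 * b ≤ S) (haS : a / r ^ 2 + b < S) ↦
    hCut M g hg p G hGs a b r ha hb hr hsub hflat hGform C S hC hS2' h2b haS
  -- all scales in `w²`-form
  obtain ⟨ψ, hψ, hψpos, hLψ, hall⟩ := GluingAllScalesSchwarzschild.allScales_clause g hg hGs hGpos hGlim ha hb hr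
    hGform hδ hBlowδ hY hYS hfac hcapall hvol hcut
  refine ⟨ψ, hψ, hψpos, hLψ, min δ 0.026 / 8, by positivity, ?_⟩
  -- `e^{−f}`-form with `w = e^{−f/2}`
  intro τ hτ f hf hnormf
  exact gluingExpForm M g hg ψ hψpos _ τ hτ (hall τ hτ) f hf hnormf

/-- **The Schwarzschild-gauge transfer stub is formally weaker than the exact-gauge one** (registered
helper `schwarzschildBlowupExistence_of_blowupExistence` of crux stmt-SmoothPoincare4-10871): lead c2's A‴
`stub_blowupExistence` (`G = a/‖y − y₀‖²` exactly on the flat ball) implies Â_b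
`stub_schwarzschildBlowupExistence` with `b = 0`. So the reshape R-c3 loses nothing, while it drops the
positive-mass rigidity of A‴ (whose blow-up is exactly Euclidean at infinity, hence flat). [folklore] -/
theorem schwarzschildBlowupExistence_of_blowupExistence :
    (∀ (M : Type) [TopologicalSpace M] [T2Space M] [SecondCountableTopology M]
      [ChartedSpace (EuclideanSpace ℝ (Fin 4)) M] [IsManifold (𝓡 4) ∞ M] [CompactSpace M]
      [T3Space M] [MeasurableSpace M] [BorelSpace M],
      M ≃ₕ Metric.sphere (0 : EuclideanSpace ℝ (Fin 5)) 1 →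
      ∃ g : PseudoRiemannianMetric (𝓡 4) ∞ (EuclideanSpace ℝ (Fin 4)) (TangentSpace (𝓡 4) : M → Type _),
      ∃ _ : g.HasLeviCivita, ∃ hg : g.IsRiemannian, ∃ p : M, ∃ G : M → ℝ, ∃ a r : ℝ,
        (ContMDiffOn (𝓡 4) 𝓘(ℝ, ℝ) ∞ G {p}ᶜ ∧ (∀ x, x ≠ p → 0 < G x) ∧
          (∀ x, x ≠ p → g.scalarCurvature x * G x - 6 * g.dalembertian G x = 0) ∧
          Tendsto G (𝓝[≠] p) atTop) ∧
        (∀ x, 0 ≤ g.scalarCurvature x) ∧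
        (∀ x, g.scalarCurvature x = 0 → x ∈ (extChartAt (𝓡 4) p).source ∧
          extChartAt (𝓡 4) p x ∈ Metric.closedBall (extChartAt (𝓡 4) p p) r) ∧
        0 < a ∧ 0 < r ∧
        (Metric.closedBall (extChartAt (𝓡 4) p p) r ⊆ (extChartAt (𝓡 4) p).target ∧
          ∀ y ∈ Metric.closedBall (extChartAt (𝓡 4) p p) r, ∀ X W : EuclideanSpace ℝ (Fin 4),
            g.val ((extChartAt (𝓡 4) p).symm y)
              (mfderiv 𝓘(ℝ, EuclideanSpace ℝ (Fin 4)) (𝓡 4) (extChartAt (𝓡 4) p).symm y X)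
              (mfderiv 𝓘(ℝ, EuclideanSpace ℝ (Fin 4)) (𝓡 4) (extChartAt (𝓡 4) p).symm y W) = ⟪X, W⟫) ∧
        (∀ y ∈ Metric.closedBall (extChartAt (𝓡 4) p p) r, y ≠ extChartAt (𝓡 4) p p →
          G ((extChartAt (𝓡 4) p).symm y) = a / ‖y - extChartAt (𝓡 4) p p‖ ^ 2) ∧
        ∃ δ : ℝ, 0 < δ ∧ ∀ τ : ℝ, 0 < τ → ∀ w : M → ℝ, ContMDiff (𝓡 4) 𝓘(ℝ, ℝ) ∞ w →
          w =ᶠ[𝓝 p] 0 →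
          ∫ x, (4 * Real.pi * τ) ^ (-(4 : ℝ) / 2) * (w x) ^ 2 * (G x) ^ 4
              ∂(riemannianMeasure (g.toContMDiffRiemannianMetric hg)) = 1 →
            Real.log 2 + Real.log Real.pi / 2 - 3 / 2 + δ ≤
              ∫ x, (4 * τ * ((G x)⁻¹ ^ 2 * g.gradSq w x) - (w x) ^ 2 * Real.log ((w x) ^ 2)
                  - 4 * (w x) ^ 2) * ((4 * Real.pi * τ) ^ (-(4 : ℝ) / 2) * (G x) ^ 4)
                ∂(riemannianMeasure (g.toContMDiffRiemannianMetric hg))) →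
    ∀ (M : Type) [TopologicalSpace M] [T2Space M] [SecondCountableTopology M]
      [ChartedSpace (EuclideanSpace ℝ (Fin 4)) M] [IsManifold (𝓡 4) ∞ M] [CompactSpace M]
      [T3Space M] [MeasurableSpace M] [BorelSpace M],
      M ≃ₕ Metric.sphere (0 : EuclideanSpace ℝ (Fin 5)) 1 →
      ∃ g : PseudoRiemannianMetric (𝓡 4) ∞ (EuclideanSpace ℝ (Fin 4)) (TangentSpace (𝓡 4) : M → Type _),
      ∃ _ : g.HasLeviCivita, ∃ hg : g.IsRiemannian, ∃ p : M, ∃ G : M → ℝ, ∃ a b r : ℝ,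
        (ContMDiffOn (𝓡 4) 𝓘(ℝ, ℝ) ∞ G {p}ᶜ ∧ (∀ x, x ≠ p → 0 < G x) ∧
          (∀ x, x ≠ p → g.scalarCurvature x * G x - 6 * g.dalembertian G x = 0) ∧
          Tendsto G (𝓝[≠] p) atTop) ∧
        (∀ x, 0 ≤ g.scalarCurvature x) ∧
        (∀ x, g.scalarCurvature x = 0 → x ∈ (extChartAt (𝓡 4) p).source ∧
          extChartAt (𝓡 4) p x ∈ Metric.closedBall (extChartAt (𝓡 4) p p) r) ∧
        0 < a ∧ 0 ≤ b ∧ 0 < r ∧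
        (Metric.closedBall (extChartAt (𝓡 4) p p) r ⊆ (extChartAt (𝓡 4) p).target ∧
          ∀ y ∈ Metric.closedBall (extChartAt (𝓡 4) p p) r, ∀ X W : EuclideanSpace ℝ (Fin 4),
          g.val ((extChartAt (𝓡 4) p).symm y)
            (mfderiv 𝓘(ℝ, EuclideanSpace ℝ (Fin 4)) (𝓡 4) (extChartAt (𝓡 4) p).symm y X)
            (mfderiv 𝓘(ℝ, EuclideanSpace ℝ (Fin 4)) (𝓡 4) (extChartAt (𝓡 4) p).symm y W) = ⟪X, W⟫) ∧
        (∀ y ∈ Metric.closedBall (extChartAt (𝓡 4) p p) r, y ≠ extChartAt (𝓡 4) p p →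
          G ((extChartAt (𝓡 4) p).symm y) = a / ‖y - extChartAt (𝓡 4) p p‖ ^ 2 + b) ∧
        ∃ δ : ℝ, 0 < δ ∧ ∀ τ : ℝ, 0 < τ → ∀ w : M → ℝ, ContMDiff (𝓡 4) 𝓘(ℝ, ℝ) ∞ w →
          w =ᶠ[𝓝 p] 0 →
          ∫ x, (4 * Real.pi * τ) ^ (-(4 : ℝ) / 2) * (w x) ^ 2 * (G x) ^ 4
              ∂(riemannianMeasure (g.toContMDiffRiemannianMetric hg)) = 1 →
            Real.log 2 + Real.log Real.pi / 2 - 3 / 2 + δ ≤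
              ∫ x, (4 * τ * ((G x)⁻¹ ^ 2 * g.gradSq w x) - (w x) ^ 2 * Real.log ((w x) ^ 2)
                  - 4 * (w x) ^ 2) * ((4 * Real.pi * τ) ^ (-(4 : ℝ) / 2) * (G x) ^ 4)
                ∂(riemannianMeasure (g.toContMDiffRiemannianMetric hg)) := by
  intro hA M _ _ _ _ _ _ _ _ _ e
  obtain ⟨g, hLC, hg, p, G, a, r, hGreen, hR0, hRzero, ha, hr, hFlat, hGform, hBlow⟩ := hA M e
  refine ⟨g, hLC, hg, p, G, a, 0, r, hGreen, hR0, hRzero, ha, le_rfl, hr, hFlat, ?_, hBlow⟩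
  intro y hy hy0
  rw [hGform y hy hy0, add_zero]

end Summit.SmoothPoincare4.SmoothPoincare4.Theorems

end
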